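/-
Copyright: cell `pub-ymgap` (HUMAN RULING D-0062), Track A of `YM-PLAN.md`, DAG node N20 (= NE7b); R134 acceleration seat
`pub-ymgap-dag-n20-c` (strategy s1, generation 9), module 47.  Released under the licence of the surrounding project.
-/
import Literature.MathematicalPhysics.QuantumFieldTheory.Balaban1983to89.Node00.SmallFieldChiOfRecord
import Literature.MathematicalPhysics.QuantumFieldTheory.Balaban1983to89.B14FlowStep
import HarnessLib

/-!
# YM-DAG node N20 (= NE7b), row s1, module 47: THE PRICE OF THE HULL-RESTRICTED PEIERLS STEP, PAID IN BAŁABAN's REGIME — the per-pinned-cube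
# rate `m·exp(C·A·M_h²·δ − δ·β·ε″²∕(2N))` of modules 39–45 is `≤ e^{−δ·p₀(g)²∕(4N·B²)} < 1`, UNIFORMLY IN THE LEVEL, once
# `p₀(g)² ≥ 4N·B²·(C·A·M_h² + log m ∕ δ)`, i.e. for every coupling `g ≤ g⋆ = exp(−½·(X∕A₀²)^{1∕(2p₀)})`

Track A of `YM-PLAN.md` (cell `pub-ymgap`, HUMAN RULING D-0062), node **N20** = spine estimate NE7b (`T4WeightBudget.RelWeightBound`, NOT
PRINTED, NOT PROVED).  Seat `pub-ymgap-dag-n20-c` (R134, s1), generation 9, module 47.  Kernel theorems only: 0 `def`, 0 `sorry`, standard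
axioms; COUNT-NEUTRAL.  Imports def-R's `Node00.SmallFieldChiOfRecord` (`epsOfRecord`, `Setup.p0Profile`) and r11's `B14FlowStep` (`log_inv_sq_mono`
BY NAME); real analysis otherwise.

THE QUESTION (referee ref-B READ-602 ∕ ERRATUM on module 39, bus l.19799–19800, «CAUTION-P»).  Modules 39–41 (and 18–23 before them) extract, per
pinned large-field cube, the rate `m · exp(C·A·M_h·M_h·δ − δ·β·(ε″²∕(2N)))` — `C` the constant of «LCS-k on the hull», `A = 2N(L² + 6((d+2)L)²)² + 2∕α`
and `M_h = (2((d+3)L+2)+1)^d·d²` n20-d's domination and hull constants (`A·M_h² ≥ 1.1 × 10²¹` at `d = 4, L = 2, N = 2`), `m` the size of the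
regularity region, `δ` the Chebyshev parameter (`δ·A·M_h ≤ a₀`), `β` the inverse coupling and `ε″` the threshold of the regularity letter `hreg`.
The referee located the price: the rate is `< 1` only if `δ·β·ε″²∕(2N)` beats `C·A·M_h²·δ + log m`.  WHERE IS IT PAID?  In Bałaban's regime — and
this file types the arithmetic: with the record's letters `β = g⁻²` and `ε″ = ε(g)∕B` (`ε(g) = g·p₀(g)`, `p₀(g) = A₀(log g⁻²)^{p₀}` — def-R's
`epsOfRecord` ∕ `Setup.p0Profile`; `B` the constant of [Balaban1985Variational] Thm 1 (9) through which `hreg` converts «minimiser `ε_{k+1}η²`-large»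
into «datum `ε″`-large», module 46 §4) one has `β·ε″² = p₀(g)²∕B²` EXACTLY (`inv_sq_mul_div_sq`), so the gain grows like `(log g⁻²)^{2p₀}` while the
loss is a CONSTANT — the located reason Bałaban's estimates hold «for g ≤ g₀ sufficiently small» ([Balaban1989LargeFieldII] p. 383 «we estimate
the factors by exp(−p₀(g_j))»; [Balaban1988Convergent] (2.4) p. 255).

WHAT THIS FILE PROVES ([folklore] real analysis; nothing of Bałaban's asserted).
* §1 `mul_exp_le_exp_neg` — for `1 ≤ m`, `0 < δ`, `0 < N`, `0 < B`, `P ∕ B² ≤ β·ε″²` and **`4N·B²·(Λ + log m ∕ δ) ≤ P`**: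
  `m·exp(Λ·δ − δ·β·(ε″²∕(2N))) ≤ exp(−(δ·P∕(4N·B²)))`; `pow_mul_exp_le_exp_neg_mul` — the `#D`-th power (one factor per pinned cube, modules 19 ∕
  28 ∕ 40) is `≤ exp(−(δ·P∕(4N·B²))·#D)`: the COST–VOLUME shape `e^{−κ·#D}` the (α)-road's `sum_admS_integral_le_of_LCS` consumes, `κ = δP∕(4NB²) > 0`.
* §2 THE PROFILE: `le_p0Profile_sq_of_le_log` — `X ≤ p₀(g)²` as soon as `(X∕A₀²)^{1∕(2p₀)} ≤ log g⁻²` (`0 < A₀`, `1 ≤ p₀`, `0 ≤ X`);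
  `le_p0Profile_sq_of_le` — MONOTONE IN THE COUPLING (r11's `B14FlowStep.log_inv_sq_mono`): if it holds at `γ` it holds at every `0 < g ≤ γ` (so along any flow in `(0, γ]`,
  `Setup.Flow.InInterval`, the threshold is met AT EVERY LEVEL with the same `X` — level-uniformity of the cost).
* §3 AT THE RECORD's LETTERS: `inv_sq_mul_div_sq` (`g⁻²·(ε(g)∕B)² = p₀(g)²∕B²`); ★ `rate_le_exp_neg_profile` (once `X ≤ p₀(g_j)²`: rate
  `≤ exp(−δ·p₀(g_j)²∕(4NB²))` — HALF of the extracted exponent survives, print's «exp(−p₀(g_j))» in the road's bookkeeping); ★★★ **`rate_le_exp_neg_of_coupling_le`** — for `0 < g ≤ γ < 1` with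
  `(X∕A₀²)^{1∕(2p₀)} ≤ log γ⁻²`, `X = 4N·B²·(Λ + log m∕δ)`: `m·exp(Λ·δ − δ·g⁻²·((ε(g)∕B)²∕(2N))) ≤ exp(−(δ·X∕(4N·B²)))` — ONE `κ` FOR ALL LEVELS of a
  run whose couplings stay in `(0, γ]`; `threshold_div_eq` ∕ `exp_neg_threshold_eq` (`κ = δΛ + log m`); `rate_pow_le_of_coupling_le` (the `#D`-th
  power); ★ `rate_lt_one_of_coupling_le`.

HONEST FRAMING.  This is WHERE the price is paid, not a payment: `C` (the level-uniform constant of «LCS-j on the hull of window-admissible pins»,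
(A1c) — THE wall) and `B` ([Balaban1985Variational] Thm 1 (9) for the local problem of record — `hreg`, K0's pen) remain displayed; given them, the
(α)-road's rate at the record is `< 1` with a level-uniform margin for every run with couplings below the explicit (absurdly small, positive)
`g⋆`: at `A·M_h² = 1.1 × 10²¹`, `C = B = m = δ = A₀ = 1`, `N = 2`, `p₀ = 2` the threshold reads `log g⁻² ≥ (8.8 × 10²¹)^{1∕4} ≈ 5.4 × 10⁵`.  NE7b NOT
PRINTED ∕ NOT PROVED; (α)-instance 0∕1; N20 NOT discharged; typed 28∕28, count untouched; one finite four-torus at fixed `ε` — NOT ℝ⁴, NOT infinite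
volume, NOT OS, NOT a mass gap, NOT Clay.

References (LOCATORS): T. Bałaban, CMP 119 (1988) 243–285 [Balaban1988Convergent] ((2.4)–(2.5) p.255); CMP 122 (1989) 355–392
[Balaban1989LargeFieldII] (p.383 l.21–28); CMP 102 (1985) 277–309 [Balaban1985Variational] (Thm 1 (9) p.279).
-/

set_option autoImplicit false

noncomputable section

namespace Summit.QuantumFields.YangMills.BalabanUVNodes.N20LCSPeierlsRegime

open Real
open Literature.MathematicalPhysics.QuantumFieldTheory.Balaban1983to89
open Literature.MathematicalPhysics.QuantumFieldTheory.Balaban1983to89.Node00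

/-! ## §1 The per-cube rate against an explicit threshold -/

section Rate

/-- **THE PER-PINNED-CUBE RATE IS `≤ e^{−δP∕(4NB²)}`** once the gain `β·ε″² ≥ P∕B²` and the threshold `4N·B²·(Λ + log m∕δ) ≤ P` hold
(`Λ` stands for the loss constant `C·A·M_h²` of modules 39–41). [folklore] -/
theorem mul_exp_le_exp_neg {m δ N B Λ β ε P : ℝ} (hm : 1 ≤ m) (hδ : 0 < δ) (hN : 0 < N) (hB : 0 < B)
    (hgain : P / B ^ 2 ≤ β * ε ^ 2) (hP : 4 * N * B ^ 2 * (Λ + Real.log m / δ) ≤ P) :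
    m * Real.exp (Λ * δ - δ * β * (ε ^ 2 / (2 * N))) ≤ Real.exp (-(δ * P / (4 * N * B ^ 2))) := by
  have hm0 : 0 < m := lt_of_lt_of_le one_pos hm
  have hB2 : 0 < B ^ 2 := by positivity
  have hNB : 0 < 4 * N * B ^ 2 := by positivity
  -- the threshold in additive form: `log m + Λδ ≤ δP/(4NB²)`
  have h1 : Real.log m + Λ * δ ≤ δ * P / (4 * N * B ^ 2) := by
    have h := mul_le_mul_of_nonneg_left hP hδ.le
    have e1 : δ * (4 * N * B ^ 2 * (Λ + Real.log m / δ)) = (4 * N * B ^ 2) * (Real.log m + Λ * δ) := by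
      field_simp
      ring
    rw [e1] at h
    rw [le_div_iff₀ hNB]
    linarith
  -- the gain in additive form: `δP/(2NB²) ≤ δβε²/(2N)`
  have h2 : δ * P / (2 * N * B ^ 2) ≤ δ * β * (ε ^ 2 / (2 * N)) := by
    have h := mul_le_mul_of_nonneg_left hgain (show 0 ≤ δ / (2 * N) by positivity)
    calc δ * P / (2 * N * B ^ 2) = δ / (2 * N) * (P / B ^ 2) := by field_simp
      _ ≤ δ / (2 * N) * (β * ε ^ 2) := h
      _ = δ * β * (ε ^ 2 / (2 * N)) := by field_simp
  have h3 : δ * P / (2 * N * B ^ 2) = 2 * (δ * P / (4 * N * B ^ 2)) := by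
    field_simp
    ring
  calc m * Real.exp (Λ * δ - δ * β * (ε ^ 2 / (2 * N)))
      = Real.exp (Real.log m + (Λ * δ - δ * β * (ε ^ 2 / (2 * N)))) := by rw [Real.exp_add, Real.exp_log hm0]
    _ ≤ Real.exp (-(δ * P / (4 * N * B ^ 2))) := Real.exp_le_exp.2 (by linarith)

/-- **ONE FACTOR PER PINNED CUBE**: the `n`-th power of the rate is `≤ e^{−(δP∕(4NB²))·n}` — the cost–volume shape `e^{−κ·#D}`. [folklore] -/
theorem pow_mul_exp_le_exp_neg_mul {m δ N B Λ β ε P : ℝ} (hm : 1 ≤ m) (hδ : 0 < δ) (hN : 0 < N) (hB : 0 < B)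
    (hgain : P / B ^ 2 ≤ β * ε ^ 2) (hP : 4 * N * B ^ 2 * (Λ + Real.log m / δ) ≤ P) (n : ℕ) :
    (m * Real.exp (Λ * δ - δ * β * (ε ^ 2 / (2 * N)))) ^ n ≤ Real.exp (-(δ * P / (4 * N * B ^ 2)) * n) := by
  rw [Real.exp_mul, Real.rpow_natCast]
  exact pow_le_pow_left₀ (mul_nonneg (le_trans zero_le_one hm) (Real.exp_nonneg _))
    (mul_exp_le_exp_neg hm hδ hN hB hgain hP) n

/-- The margin is positive whenever the threshold `P` is: `e^{−δP∕(4NB²)} < 1`. [folklore] -/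
theorem exp_neg_lt_one {δ N B P : ℝ} (hδ : 0 < δ) (hN : 0 < N) (hB : 0 < B) (hP : 0 < P) :
    Real.exp (-(δ * P / (4 * N * B ^ 2))) < 1 := by
  rw [Real.exp_lt_one_iff]
  have : 0 < δ * P / (4 * N * B ^ 2) := by positivity
  linarith

end Rate

/-! ## §2 The small-field profile against a constant threshold -/

section Profile

/-- **`X ≤ p₀(g)²` AS SOON AS `(X∕A₀²)^{1∕(2p₀)} ≤ log g⁻²`** (`p₀(g) = A₀(log g⁻²)^{p₀}`, `0 < A₀`, `1 ≤ p₀`, `0 ≤ X`): the gain of the record's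
thresholds grows like `(log g⁻²)^{2p₀}`, any constant loss is eventually beaten. [cite: Balaban1988Convergent, (2.4) p.255] -/
theorem le_p0Profile_sq_of_le_log {A₀ X g : ℝ} {p₀ : ℕ} (hA : 0 < A₀) (hp : 1 ≤ p₀) (hX : 0 ≤ X)
    (hlog : (X / A₀ ^ 2) ^ ((1 : ℝ) / (2 * p₀)) ≤ Real.log (g ^ 2)⁻¹) :
    X ≤ p0Profile A₀ p₀ g ^ 2 := by
  have hy : 0 ≤ X / A₀ ^ 2 := by positivity
  have hbase : 0 ≤ (X / A₀ ^ 2) ^ ((1 : ℝ) / (2 * p₀)) := Real.rpow_nonneg hy _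
  have hp0 : (0 : ℝ) < 2 * p₀ := by
    have : (1 : ℝ) ≤ p₀ := by exact_mod_cast hp
    linarith
  -- raise `hlog` to the power `2p₀`
  have h1 : ((X / A₀ ^ 2) ^ ((1 : ℝ) / (2 * p₀))) ^ (2 * p₀) ≤ (Real.log (g ^ 2)⁻¹) ^ (2 * p₀) :=
    pow_le_pow_left₀ hbase hlog _
  have h2 : ((X / A₀ ^ 2) ^ ((1 : ℝ) / (2 * p₀))) ^ (2 * p₀) = X / A₀ ^ 2 := by
    rw [← Real.rpow_natCast, ← Real.rpow_mul hy]
    have : (1 : ℝ) / (2 * p₀) * ((2 * p₀ : ℕ) : ℝ) = 1 := by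
      push_cast
      field_simp
    rw [this, Real.rpow_one]
  rw [h2] at h1
  unfold p0Profile
  rw [mul_pow, ← pow_mul, mul_comm p₀ 2]
  rw [div_le_iff₀ (by positivity)] at h1
  linarith [h1]

/-- **MONOTONE IN THE COUPLING**: if the threshold is met at `γ` then it is met at every `0 < g ≤ γ` — so along any run whose couplings stay in
`(0, γ]` (`Setup.Flow.InInterval`) ONE `X` serves EVERY level. [cite: Balaban1988Convergent, (2.4) p.255] -/
theorem le_p0Profile_sq_of_le {A₀ X g γ : ℝ} {p₀ : ℕ} (hA : 0 < A₀) (hp : 1 ≤ p₀) (hX : 0 ≤ X) (hg : 0 < g) (hle : g ≤ γ)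
    (hlog : (X / A₀ ^ 2) ^ ((1 : ℝ) / (2 * p₀)) ≤ Real.log (γ ^ 2)⁻¹) :
    X ≤ p0Profile A₀ p₀ g ^ 2 :=
  le_p0Profile_sq_of_le_log hA hp hX (hlog.trans (B14FlowStep.log_inv_sq_mono hg hle))

end Profile

/-! ## §3 At the record's letters: `β = g⁻²`, `ε″ = ε(g)∕B` -/

section AtRecord

variable (ν : Stage7Numerics) (g : ℕ → ℝ) (j : ℕ)

/-- **THE GAIN AT THE RECORD's LETTERS IS `p₀(g)²∕B²` EXACTLY**: `g⁻²·(ε(g)∕B)² = p₀(g)²∕B²` with `ε(g) = g·p₀(g)` (def-R's `epsOfRecord`), `g ≠ 0`.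
[cite: Balaban1988Convergent, (2.4) p.255] -/
theorem inv_sq_mul_div_sq {B : ℝ} (hg : g j ≠ 0) :
    ((g j) ^ 2)⁻¹ * (epsOfRecord ν g j / B) ^ 2 = p0Profile ν.A₀ ν.p₀ (g j) ^ 2 / B ^ 2 := by
  unfold epsOfRecord
  field_simp

/-- ★ **HALF OF THE EXTRACTED EXPONENT SURVIVES**: at the record's letters, once `X = 4N·B²·(Λ + log m∕δ) ≤ p₀(g_j)²`, the per-pinned-cube rate is
`≤ exp(−δ·p₀(g_j)²∕(4N·B²))` — print's «we estimate the factors by exp(−p₀(g_j))» in the (α)-road's bookkeeping, with the explicit fraction `δ∕(4NB²)`.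
[cite: Balaban1989LargeFieldII, p.383; Balaban1988Convergent, (2.4) p.255] -/
theorem rate_le_exp_neg_profile {m δ N' B Λ : ℝ} (hm : 1 ≤ m) (hδ : 0 < δ) (hN : 0 < N') (hB : 0 < B) (hg : g j ≠ 0)
    (hP : 4 * N' * B ^ 2 * (Λ + Real.log m / δ) ≤ p0Profile ν.A₀ ν.p₀ (g j) ^ 2) :
    m * Real.exp (Λ * δ - δ * ((g j) ^ 2)⁻¹ * ((epsOfRecord ν g j / B) ^ 2 / (2 * N'))) ≤
      Real.exp (-(δ * p0Profile ν.A₀ ν.p₀ (g j) ^ 2 / (4 * N' * B ^ 2))) :=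
  mul_exp_le_exp_neg hm hδ hN hB (le_of_eq (inv_sq_mul_div_sq ν g j hg).symm) hP

/-- ★★★ **THE RATE IN BAŁABAN's REGIME, LEVEL-UNIFORMLY**: for a coupling `0 < g_j ≤ γ` with `(X∕A₀²)^{1∕(2p₀)} ≤ log γ⁻²`,
`X = 4N·B²·(Λ + log m∕δ)` (`0 < A₀`, `1 ≤ p₀`, `0 ≤ X`), the per-pinned-cube rate of modules 39–41 read at `β = g_j⁻²`, `ε″ = ε(g_j)∕B` satisfies
`m·exp(Λ·δ − δ·g_j⁻²·((ε(g_j)∕B)²∕(2N))) ≤ exp(−(δ·X∕(4N·B²)))` — the SAME bound at every level `j` of a run with couplings in `(0, γ]`.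
[cite: Balaban1989LargeFieldII, p.383; Balaban1988Convergent, (2.4) p.255] -/
theorem rate_le_exp_neg_of_coupling_le {m δ N' B Λ γ : ℝ} (hm : 1 ≤ m) (hδ : 0 < δ) (hN : 0 < N') (hB : 0 < B)
    (hA : 0 < ν.A₀) (hp : 1 ≤ ν.p₀) (hX : 0 ≤ 4 * N' * B ^ 2 * (Λ + Real.log m / δ))
    (hg : 0 < g j) (hle : g j ≤ γ)
    (hlog : (4 * N' * B ^ 2 * (Λ + Real.log m / δ) / ν.A₀ ^ 2) ^ ((1 : ℝ) / (2 * ν.p₀)) ≤ Real.log (γ ^ 2)⁻¹) :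
    m * Real.exp (Λ * δ - δ * ((g j) ^ 2)⁻¹ * ((epsOfRecord ν g j / B) ^ 2 / (2 * N'))) ≤
      Real.exp (-(δ * (4 * N' * B ^ 2 * (Λ + Real.log m / δ)) / (4 * N' * B ^ 2))) := by
  refine mul_exp_le_exp_neg hm hδ hN hB ?_ le_rfl
  rw [inv_sq_mul_div_sq ν g j hg.ne']
  exact div_le_div_of_nonneg_right (le_p0Profile_sq_of_le hA hp hX hg hle hlog) (by positivity)

/-- The exponent simplifies: `δ·X∕(4NB²) = δ·(Λ + log m∕δ)` at `X = 4NB²(Λ + log m∕δ)` — the margin is `δΛ + log m`. [folklore] -/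
theorem threshold_div_eq {m δ N' B Λ : ℝ} (hN : 0 < N') (hB : 0 < B) :
    δ * (4 * N' * B ^ 2 * (Λ + Real.log m / δ)) / (4 * N' * B ^ 2) = δ * (Λ + Real.log m / δ) := by
  have : (4 * N' * B ^ 2 : ℝ) ≠ 0 := by positivity
  field_simp

/-- … so the rate is at most `e^{−(δΛ + log m)} = e^{−δΛ}∕m` in exponential form. [folklore] -/
theorem exp_neg_threshold_eq {m δ N' B Λ : ℝ} (hN : 0 < N') (hB : 0 < B) :
    Real.exp (-(δ * (4 * N' * B ^ 2 * (Λ + Real.log m / δ)) / (4 * N' * B ^ 2))) = Real.exp (-(δ * (Λ + Real.log m / δ))) := by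
  rw [threshold_div_eq hN hB]

/-- ★ **ONE FACTOR PER PINNED CUBE, LEVEL-UNIFORMLY**: the `#D`-th power of the rate at level `j` is `≤ exp(−(δ·X∕(4N·B²))·#D)`.
[cite: Balaban1989LargeFieldII, p.383] -/
theorem rate_pow_le_of_coupling_le {m δ N' B Λ γ : ℝ} (hm : 1 ≤ m) (hδ : 0 < δ) (hN : 0 < N') (hB : 0 < B)
    (hA : 0 < ν.A₀) (hp : 1 ≤ ν.p₀) (hX : 0 ≤ 4 * N' * B ^ 2 * (Λ + Real.log m / δ))
    (hg : 0 < g j) (hle : g j ≤ γ)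
    (hlog : (4 * N' * B ^ 2 * (Λ + Real.log m / δ) / ν.A₀ ^ 2) ^ ((1 : ℝ) / (2 * ν.p₀)) ≤ Real.log (γ ^ 2)⁻¹) (n : ℕ) :
    (m * Real.exp (Λ * δ - δ * ((g j) ^ 2)⁻¹ * ((epsOfRecord ν g j / B) ^ 2 / (2 * N')))) ^ n ≤
      Real.exp (-(δ * (4 * N' * B ^ 2 * (Λ + Real.log m / δ)) / (4 * N' * B ^ 2)) * n) := by
  refine pow_mul_exp_le_exp_neg_mul hm hδ hN hB ?_ le_rfl n
  rw [inv_sq_mul_div_sq ν g j hg.ne']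
  exact div_le_div_of_nonneg_right (le_p0Profile_sq_of_le hA hp hX hg hle hlog) (by positivity)

/-- ★ **THE RATE IS `< 1`** in the regime, as soon as the threshold `X` is positive (e.g. `Λ > 0` or `m > 1`). [cite: Balaban1989LargeFieldII, p.383] -/
theorem rate_lt_one_of_coupling_le {m δ N' B Λ γ : ℝ} (hm : 1 ≤ m) (hδ : 0 < δ) (hN : 0 < N') (hB : 0 < B)
    (hA : 0 < ν.A₀) (hp : 1 ≤ ν.p₀) (hX : 0 < 4 * N' * B ^ 2 * (Λ + Real.log m / δ))
    (hg : 0 < g j) (hle : g j ≤ γ)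
    (hlog : (4 * N' * B ^ 2 * (Λ + Real.log m / δ) / ν.A₀ ^ 2) ^ ((1 : ℝ) / (2 * ν.p₀)) ≤ Real.log (γ ^ 2)⁻¹) :
    m * Real.exp (Λ * δ - δ * ((g j) ^ 2)⁻¹ * ((epsOfRecord ν g j / B) ^ 2 / (2 * N'))) < 1 :=
  (rate_le_exp_neg_of_coupling_le ν g j hm hδ hN hB hA hp hX.le hg hle hlog).trans_lt (exp_neg_lt_one hδ hN hB hX)

end AtRecord

end Summit.QuantumFields.YangMills.BalabanUVNodes.N20LCSPeierlsRegime

end
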